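import Mathlib.Data.Real.Basic
import Mathlib.Tactic.Ring
import Mathlib.Tactic.Linarith
import Mathlib.Tactic.Positivity
import Mathlib.Tactic.FinCases
import HarnessLib

/-!
# `NoHeavyLowerTail` (crux stmt-CriticalPhenomena-4575): series–parallel SUBSTITUTION preserves three-copy comb (tensor-Bernstein) positivity — the algebraic lemma behind
# the K7 reduction of the bounded-n certificates (prim-bnk-2 K7-REDUCTION.md Lemma 2) and the "all series–parallel extensions" corollary (prim-bnk-1)

Support file (prover seat `prim-bnk-1`; `--supports stmt-CriticalPhenomena-4575`; pure algebra over a commutative ring / ordered field, no measure theory, no `native_decide`).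

A polynomial `P(w)` of degree ≤ 3 in each edge weight is COMB POSITIVE if all its coefficients in the tensor basis `∏_e w_e^{k_e}(1−w_e)^{3−k_e}` (`k_e ∈ {0,1,2,3}`) are `≥ 0`
(= all three-copy fibre sums `≥ 0`; `…E3GroupSepCertCheck.checkC`).  Replacing one edge by two PARALLEL edges substitutes `w = 1 − (1−s)(1−t)`; by two edges in SERIES (through a
fresh vertex touching nothing else) substitutes `w = s·t`.  In the one variable concerned, with `B₀(y) = (1−y)³, B₁(y) = y(1−y)², B₂(y) = y²(1−y), B₃(y) = y³`:

* `bern3_parallel` : `Σ_d r_d B_d(1−(1−s)(1−t)) = Σ_{i,j} c_{ij} B_i(s) B_j(t)` with the explicit ℕ-combinations `c_{ij}` of `r₀..r₃` written out (`ring`);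
* `bern3_series`   : the same for `y = s·t` (degree elevation in `t` where needed);
* `bern3_parallel_coeff_nonneg`, `bern3_series_coeff_nonneg` : `r_d ≥ 0 ⇒` every `c_{ij} ≥ 0` (ordered field).
Applied coefficientwise (the `r_d` being the coefficient arrays in the remaining variables), comb positivity of a row on `K_n` transfers to every multigraph obtained by doubling
edges and to every graph obtained by subdividing edges, hence (iterating) to every graph obtained from a `≤ n`-vertex graph by replacing edges with two-terminal series–parallel
networks; and the `w_e = 1` faces of `K_{n+1}` (contractions, which create parallel pairs) are discharged by `K_n` — prim-bnk-2's Lemma 2.  Nothing here is specific to percolation.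
-/

namespace Summit.CriticalPhenomena.PercolationContinuityZ3.Theorems.CombSubstitution

section Ring

variable {R : Type*} [CommRing R]

/-- The (unnormalised) cubic Bernstein basis `B₀ = (1−y)³, B₁ = y(1−y)², B₂ = y²(1−y), B₃ = y³`. [folklore] -/
def B (d : Fin 4) (y : R) : R :=
  match d with
  | 0 => (1 - y) ^ 3
  | 1 => y * (1 - y) ^ 2
  | 2 => y ^ 2 * (1 - y)
  | 3 => y ^ 3

/-- A cubic in Bernstein form with coefficients `r₀..r₃`. [folklore] -/
def bern3 (r₀ r₁ r₂ r₃ y : R) : R := r₀ * B 0 y + r₁ * B 1 y + r₂ * B 2 y + r₃ * B 3 y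

/-- **Parallel substitution `y = 1 − (1−s)(1−t)`** in the cubic Bernstein basis: an explicit expansion in the products `B_i(s)B_j(t)` with natural-number combinations
of `r₀..r₃` as coefficients (`B₀ ↦ B₀B₀`; `B₁ ↦ B₁B₀+B₀B₁+B₁B₁`; `B₂ ↦ B₂B₀+B₀B₂+B₂B₂+2B₁B₁+2B₂B₁+2B₁B₂`;
`B₃ ↦ B₃B₀+B₀B₃+B₃B₃+3B₂B₁+3B₁B₂+3B₃B₁+3B₁B₃+3B₃B₂+3B₂B₃+6B₂B₂`). [this work] -/
theorem bern3_parallel (r₀ r₁ r₂ r₃ s t : R) :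
    bern3 r₀ r₁ r₂ r₃ (1 - (1 - s) * (1 - t)) =
      r₀ * (B 0 s * B 0 t)
      + r₁ * (B 1 s * B 0 t + B 0 s * B 1 t + B 1 s * B 1 t)
      + r₂ * (B 2 s * B 0 t + B 0 s * B 2 t + B 2 s * B 2 t + 2 * (B 1 s * B 1 t) + 2 * (B 2 s * B 1 t) + 2 * (B 1 s * B 2 t))
      + r₃ * (B 3 s * B 0 t + B 0 s * B 3 t + B 3 s * B 3 t + 3 * (B 2 s * B 1 t) + 3 * (B 1 s * B 2 t) + 3 * (B 3 s * B 1 t)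
          + 3 * (B 1 s * B 3 t) + 3 * (B 3 s * B 2 t) + 3 * (B 2 s * B 3 t) + 6 * (B 2 s * B 2 t)) := by
  simp only [bern3, B]
  ring

/-- **Series substitution `y = s·t`** in the cubic Bernstein basis (with degree elevation in `t`):
`B₃ ↦ B₃B₃`; `B₂ ↦ B₂(B₂+B₃) + B₃B₂`; `B₁ ↦ B₁(B₁+2B₂+B₃) + 2B₂(B₁+B₂) + B₃B₁`; `B₀ ↦ B₀(B₀+3B₁+3B₂+B₃) + 3B₁(B₀+2B₁+B₂) + 3B₂(B₀+B₁) + B₃B₀`. [this work] -/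
theorem bern3_series (r₀ r₁ r₂ r₃ s t : R) :
    bern3 r₀ r₁ r₂ r₃ (s * t) =
      r₀ * (B 0 s * (B 0 t + 3 * B 1 t + 3 * B 2 t + B 3 t) + 3 * (B 1 s * (B 0 t + 2 * B 1 t + B 2 t)) + 3 * (B 2 s * (B 0 t + B 1 t)) + B 3 s * B 0 t)
      + r₁ * (B 1 s * (B 1 t + 2 * B 2 t + B 3 t) + 2 * (B 2 s * (B 1 t + B 2 t)) + B 3 s * B 1 t)
      + r₂ * (B 2 s * (B 2 t + B 3 t) + B 3 s * B 2 t)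
      + r₃ * (B 3 s * B 3 t) := by
  simp only [bern3, B]
  ring

/-- The parallel expansion regrouped as `Σ_{i,j} c_{ij} B_i(s) B_j(t)` with the sixteen coefficients
`c₀₀ = r₀, c₁₀ = c₀₁ = r₁, c₁₁ = r₁+2r₂, c₂₀ = c₀₂ = r₂, c₂₁ = c₁₂ = 2r₂+3r₃, c₂₂ = r₂+6r₃, c₃₀ = c₀₃ = r₃, c₃₁ = c₁₃ = c₃₂ = c₂₃ = 3r₃, c₃₃ = r₃`. [this work] -/
theorem bern3_parallel_coeff (r₀ r₁ r₂ r₃ s t : R) :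
    bern3 r₀ r₁ r₂ r₃ (1 - (1 - s) * (1 - t)) =
      r₀ * (B 0 s * B 0 t) + r₁ * (B 1 s * B 0 t) + r₁ * (B 0 s * B 1 t) + (r₁ + 2 * r₂) * (B 1 s * B 1 t)
      + r₂ * (B 2 s * B 0 t) + r₂ * (B 0 s * B 2 t) + (2 * r₂ + 3 * r₃) * (B 2 s * B 1 t) + (2 * r₂ + 3 * r₃) * (B 1 s * B 2 t) + (r₂ + 6 * r₃) * (B 2 s * B 2 t)
      + r₃ * (B 3 s * B 0 t) + r₃ * (B 0 s * B 3 t) + 3 * r₃ * (B 3 s * B 1 t) + 3 * r₃ * (B 1 s * B 3 t) + 3 * r₃ * (B 3 s * B 2 t) + 3 * r₃ * (B 2 s * B 3 t)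
      + r₃ * (B 3 s * B 3 t) := by
  rw [bern3_parallel]
  ring

/-- The series expansion regrouped as `Σ_{i,j} c'_{ij} B_i(s) B_j(t)`:
`c'₀₀ = r₀, c'₀₁ = 3r₀, c'₀₂ = 3r₀, c'₀₃ = r₀, c'₁₀ = 3r₀, c'₁₁ = 6r₀+r₁, c'₁₂ = 3r₀+2r₁, c'₁₃ = r₁, c'₂₀ = 3r₀, c'₂₁ = 3r₀+2r₁, c'₂₂ = 2r₁+r₂, c'₂₃ = r₂, c'₃₀ = r₀, c'₃₁ = r₁, c'₃₂ = r₂, c'₃₃ = r₃`.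
[this work] -/
theorem bern3_series_coeff (r₀ r₁ r₂ r₃ s t : R) :
    bern3 r₀ r₁ r₂ r₃ (s * t) =
      r₀ * (B 0 s * B 0 t) + 3 * r₀ * (B 0 s * B 1 t) + 3 * r₀ * (B 0 s * B 2 t) + r₀ * (B 0 s * B 3 t)
      + 3 * r₀ * (B 1 s * B 0 t) + (6 * r₀ + r₁) * (B 1 s * B 1 t) + (3 * r₀ + 2 * r₁) * (B 1 s * B 2 t) + r₁ * (B 1 s * B 3 t)
      + 3 * r₀ * (B 2 s * B 0 t) + (3 * r₀ + 2 * r₁) * (B 2 s * B 1 t) + (2 * r₁ + r₂) * (B 2 s * B 2 t) + r₂ * (B 2 s * B 3 t)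
      + r₀ * (B 3 s * B 0 t) + r₁ * (B 3 s * B 1 t) + r₂ * (B 3 s * B 2 t) + r₃ * (B 3 s * B 3 t) := by
  rw [bern3_series]
  ring

end Ring

/-! ### Nonnegativity of the substituted coefficients (ordered field) -/

/-- **Parallel substitution preserves comb positivity (one variable, the rest as coefficients):** if `r₀..r₃ ≥ 0` then all sixteen coefficients `c_{ij}` of
`bern3_parallel_coeff` are `≥ 0`. [this work] -/
theorem bern3_parallel_coeff_nonneg {r₀ r₁ r₂ r₃ : ℝ} (h₀ : 0 ≤ r₀) (h₁ : 0 ≤ r₁) (h₂ : 0 ≤ r₂) (h₃ : 0 ≤ r₃) :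
    0 ≤ r₀ ∧ 0 ≤ r₁ ∧ 0 ≤ r₁ + 2 * r₂ ∧ 0 ≤ r₂ ∧ 0 ≤ 2 * r₂ + 3 * r₃ ∧ 0 ≤ r₂ + 6 * r₃ ∧ 0 ≤ r₃ ∧ 0 ≤ 3 * r₃ := by
  refine ⟨h₀, h₁, by linarith, h₂, by linarith, by linarith, h₃, by linarith⟩

/-- **Series substitution preserves comb positivity:** if `r₀..r₃ ≥ 0` then all sixteen coefficients `c'_{ij}` of `bern3_series_coeff` are `≥ 0`. [this work] -/
theorem bern3_series_coeff_nonneg {r₀ r₁ r₂ r₃ : ℝ} (h₀ : 0 ≤ r₀) (h₁ : 0 ≤ r₁) (h₂ : 0 ≤ r₂) (h₃ : 0 ≤ r₃) :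
    0 ≤ r₀ ∧ 0 ≤ 3 * r₀ ∧ 0 ≤ 6 * r₀ + r₁ ∧ 0 ≤ 3 * r₀ + 2 * r₁ ∧ 0 ≤ r₁ ∧ 0 ≤ 2 * r₁ + r₂ ∧ 0 ≤ r₂ ∧ 0 ≤ r₃ := by
  refine ⟨h₀, by linarith, by linarith, by linarith, h₁, by linarith, h₂, h₃⟩

/-- **The substituted cubic is nonnegative on the unit square when `r ≥ 0`** (direct consequence; parallel case). [this work] -/
theorem bern3_parallel_nonneg {r₀ r₁ r₂ r₃ s t : ℝ} (h₀ : 0 ≤ r₀) (h₁ : 0 ≤ r₁) (h₂ : 0 ≤ r₂) (h₃ : 0 ≤ r₃)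
    (hs₀ : 0 ≤ s) (hs₁ : s ≤ 1) (ht₀ : 0 ≤ t) (ht₁ : t ≤ 1) : 0 ≤ bern3 r₀ r₁ r₂ r₃ (1 - (1 - s) * (1 - t)) := by
  have hs : 0 ≤ 1 - s := by linarith
  have ht : 0 ≤ 1 - t := by linarith
  have hB : ∀ d : Fin 4, ∀ y : ℝ, 0 ≤ y → 0 ≤ 1 - y → 0 ≤ B d y := by
    intro d y hy hy'
    fin_cases d <;> simp only [B] <;> positivity
  rw [bern3_parallel_coeff]
  have := hB 0 s hs₀ hs; have := hB 1 s hs₀ hs; have := hB 2 s hs₀ hs; have := hB 3 s hs₀ hs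
  have := hB 0 t ht₀ ht; have := hB 1 t ht₀ ht; have := hB 2 t ht₀ ht; have := hB 3 t ht₀ ht
  positivity

/-- **The substituted cubic is nonnegative on the unit square when `r ≥ 0`** (series case). [this work] -/
theorem bern3_series_nonneg {r₀ r₁ r₂ r₃ s t : ℝ} (h₀ : 0 ≤ r₀) (h₁ : 0 ≤ r₁) (h₂ : 0 ≤ r₂) (h₃ : 0 ≤ r₃)
    (hs₀ : 0 ≤ s) (hs₁ : s ≤ 1) (ht₀ : 0 ≤ t) (ht₁ : t ≤ 1) : 0 ≤ bern3 r₀ r₁ r₂ r₃ (s * t) := by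
  have hs : 0 ≤ 1 - s := by linarith
  have ht : 0 ≤ 1 - t := by linarith
  have hB : ∀ d : Fin 4, ∀ y : ℝ, 0 ≤ y → 0 ≤ 1 - y → 0 ≤ B d y := by
    intro d y hy hy'
    fin_cases d <;> simp only [B] <;> positivity
  rw [bern3_series_coeff]
  have := hB 0 s hs₀ hs; have := hB 1 s hs₀ hs; have := hB 2 s hs₀ hs; have := hB 3 s hs₀ hs
  have := hB 0 t ht₀ ht; have := hB 1 t ht₀ ht; have := hB 2 t ht₀ ht; have := hB 3 t ht₀ ht
  positivity

end Summit.CriticalPhenomena.PercolationContinuityZ3.Theorems.CombSubstitution
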